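import Summits.RiemannHypothesis.RiemannHypothesis.Theorems.SemilocalDeletionDipole
import HarnessLib

/-!
# Two-prime deletion under two-dimensional alternating combs: the costs ADD, with no interaction term

`SemilocalDeletionAllPowers.lean` (p379345) showed with one-dimensional alternating combs that the all-window deletion floor
`F_p = 2·log p/(√p + 1)` of ONE prime is sharp.  Here two DISTINCT primes `p, q ∈ S` are deleted at once.  The test functions are the
TWO-DIMENSIONAL alternating combs

  `G(t) = Σ_{i ≤ n, j ≤ n'} (−1)^{i+j} h(t + C − i·L − j·M)`,  `L = log p`, `M = log q`, `C = (nL + n'M)/2`,  `h ∈ C(δ)`,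

whose blocks sit at the points of the rank-2 lattice `ℤL + ℤM` — pairwise distinct because `log p/log q` is irrational — so that, once
`2δ` is below the LATTICE SEPARATION `min |aL + bM|` over the relevant box (hypothesis `hsep`; for distinct primes it holds for every
small `δ`, see the sequel `SemilocalDeletionPairCombsExist`), the blocks never overlap and (§1, `weilConv_weilReflect_comb2_lag`)

  `k_G(dL + eM) = (−1)^{d+e}·(n+1−d)₊·(n'+1−e)₊·‖h‖₂²`,   `‖G‖₂² = (n+1)(n'+1)‖h‖₂²`.

With the all-powers deletion identity at a lag variable (§2, `re_erase_sub_eq_sum_lag`, the `L = log p` form of p379345's §1) this gives (§3):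

* `re_erase_comb2`: `Re Q_{S∖p}(G) − Re Q_S(G) = 2L(n'+1)‖h‖₂²·Σ_{d<n}(n−d)(−1/√p)^{d+1}` — the second prime's blocks only MULTIPLY the
  one-prime comb value (`SemilocalDeletionAllPowers.re_weilSemilocalQuadratic_erase_comb`) by `n'+1`;
* `re_erase_erase_comb2` (★): `Re Q_{S∖{p,q}}(G) − Re Q_S(G) = 2‖h‖₂²·[(n'+1)L·Σ_{d<n}(n−d)(−1/√p)^{d+1} + (n+1)M·Σ_{e<n'}(n'−e)(−1/√q)^{e+1}]`
  — EXACTLY the sum of the two one-prime values: NO INTERACTION TERM.  Divided by `‖G‖₂²` and with `n, n' → ∞` the quotient tends to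
  `−(F_p + F_q)`: the two-prime ALL-WINDOW deletion floor is ADDITIVE (the lower bound `≥ −(F_p + F_q)` at every window is the set
  version of the all-window floor, desk file `SemilocalDeletionAllWindowFloor`; the packaged `≤ −[F_p(n−1)/(n+1) + F_q(n'−1)/(n'+1)]‖G‖₂²`
  form and the existence of separated combs are in the sequel).

So the prime–prime INTERACTION of deletion costs measured at finite windows (lineage E; the zero-parameter «KMS orbit-geometry» model of
HOME/cc-s2-1/gen14/PREREG-ccs21-g14-pairwindow.md) is a FINITE-WINDOW effect of the joint orbit graph; it vanishes in the all-window limit.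
Nothing here bears on RH; these are statements about truncated Weil forms.
-/

set_option linter.dupNamespace false

noncomputable section

open Complex Filter Set MeasureTheory
open scoped Real Topology ComplexConjugate

namespace Summit.RiemannHypothesis.RiemannHypothesis.Theorems.SemilocalDeletionPairCombs

open Literature.NumberTheory.LFunctions
open Summit.RiemannHypothesis.RiemannHypothesis.Theorems.SemilocalDeletionCliff
open Summit.RiemannHypothesis.RiemannHypothesis.Theorems.SemilocalDeletionDipole
open Summit.RiemannHypothesis.RiemannHypothesis.Theorems.HandoffSemilocalEnergy

/-! ## §1  Two-dimensional alternating combs `G = Σ_{i≤n, j≤n'} (−1)^{i+j} h(· + C − iL − jM)`, `C = (nL + n'M)/2` -/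

section Comb

variable {h : ℝ → ℂ} {δ L M : ℝ} {n n' : ℕ} {A B : ℕ} {G : ℝ → ℂ}
  (hG : ∀ t : ℝ, G t = ∑ ij ∈ Finset.range (n + 1) ×ˢ Finset.range (n' + 1),
    ((-1 : ℂ) ^ (ij.1 + ij.2)) * h (t + (n * L + n' * M) / 2 - ij.1 * L - ij.2 * M))
  (hsep : ∀ a b : ℤ, |a| ≤ A → |b| ≤ B → (a ≠ 0 ∨ b ≠ 0) → 2 * δ < |(a : ℝ) * L + b * M|)

include hsep in
/-- Blocks of the 2D comb at lattice offset never overlap unless the lattice vector vanishes: for `|i' − i + d| ≤ A`, `|j' − j + e| ≤ B`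
and `(i, j) ≠ (i' + d, j' + e)`, `h(u + C − iL − jM)·conj h(u − (dL + eM) + C − i'L − j'M) = 0`. -/
theorem block2_mul_conj_eq_zero (hsupp : tsupport h ⊆ Icc (-δ) δ) {i j i' j' : ℕ} {d e : ℤ}
    (ha : |(i' : ℤ) - i + d| ≤ A) (hb : |(j' : ℤ) - j + e| ≤ B) (hne : ¬ ((i : ℤ) = i' + d ∧ (j : ℤ) = j' + e)) (u : ℝ) :
    h (u + (n * L + n' * M) / 2 - i * L - j * M) * conj (h (u - (d * L + e * M) + (n * L + n' * M) / 2 - i' * L - j' * M)) = 0 := by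
  refine mul_conj_eq_zero_of_far hsupp ?_
  have hdiff : u + (n * L + n' * M) / 2 - i * L - j * M - (u - (d * L + e * M) + (n * L + n' * M) / 2 - i' * L - j' * M) =
      (((i' : ℤ) - i + d : ℤ) : ℝ) * L + (((j' : ℤ) - j + e : ℤ) : ℝ) * M := by push_cast; ring
  rw [hdiff]
  exact hsep _ _ ha hb (by omega)

include hG in
/-- The 2D comb of a test function `h ∈ C(δ)` is a test function supported in `[−((nL + n'M)/2 + δ), (nL + n'M)/2 + δ]` (`L, M ≥ 0`). -/
theorem comb2_isWeilTest_tsupport (hh : IsWeilTest h) (hsupp : tsupport h ⊆ Icc (-δ) δ) (hL : 0 ≤ L) (hM : 0 ≤ M) :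
    IsWeilTest G ∧ tsupport G ⊆ Icc (-((n * L + n' * M) / 2 + δ)) ((n * L + n' * M) / 2 + δ) := by
  classical
  have key : ∀ s : Finset (ℕ × ℕ), IsWeilTest fun t ↦ ∑ ij ∈ s, ((-1 : ℂ) ^ (ij.1 + ij.2)) * h (t + (n * L + n' * M) / 2 - ij.1 * L - ij.2 * M) := by
    intro s
    induction s using Finset.induction_on with
    | empty => simpa using (show IsWeilTest fun _ : ℝ ↦ (0 : ℂ) by simpa using hh.const_mul 0)
    | @insert ij s hij ih =>
      have h1 := ((hh.weilTranslate (ij.1 * L + ij.2 * M - (n * L + n' * M) / 2)).const_mul ((-1 : ℂ) ^ (ij.1 + ij.2))).add ih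
      convert h1 using 1
      funext t
      rw [Finset.sum_insert hij]
      simp only [Pi.add_apply, weilTranslate]
      ring_nf
  have hGfun : G = fun t ↦ ∑ ij ∈ Finset.range (n + 1) ×ˢ Finset.range (n' + 1),
      ((-1 : ℂ) ^ (ij.1 + ij.2)) * h (t + (n * L + n' * M) / 2 - ij.1 * L - ij.2 * M) := funext hG
  refine ⟨hGfun ▸ key _, (isClosed_Icc.closure_subset_iff).2 fun t ht ↦ ?_⟩
  rw [Function.mem_support, hG] at ht
  obtain ⟨ij, hij, hne⟩ := Finset.exists_ne_zero_of_sum_ne_zero ht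
  rw [Finset.mem_product, Finset.mem_range, Finset.mem_range] at hij
  have hi' : (ij.1 : ℝ) ≤ n := by exact_mod_cast Nat.lt_succ_iff.1 hij.1
  have hj' : (ij.2 : ℝ) ≤ n' := by exact_mod_cast Nat.lt_succ_iff.1 hij.2
  have hne' : h (t + (n * L + n' * M) / 2 - ij.1 * L - ij.2 * M) ≠ 0 := fun h0 ↦ hne (by rw [h0, mul_zero])
  have := hsupp (subset_tsupport _ (Function.mem_support.2 hne'))
  rw [mem_Icc] at this ⊢
  have hi0 : (0 : ℝ) ≤ ij.1 := Nat.cast_nonneg _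
  have hj0 : (0 : ℝ) ≤ ij.2 := Nat.cast_nonneg _
  constructor <;> nlinarith [this.1, this.2]

include hG hsep in
/-- **Lattice autocorrelations of the 2D comb.** For `h ∈ C(δ)` and the separation hypothesis with `n + d ≤ A`, `n' + e ≤ B`:
`k_G(dL + eM) = (−1)^{d+e}(n + 1 − d)₊(n' + 1 − e)₊‖h‖₂²` (truncated subtraction: the comb has NO autocorrelation at lags `dL + eM` with `d > n` or `e > n'`). -/
theorem weilConv_weilReflect_comb2_lag (hh : IsWeilTest h) (hsupp : tsupport h ⊆ Icc (-δ) δ) {d e : ℕ}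
    (hA : n + d ≤ A) (hB : n' + e ≤ B) :
    weilConv G (weilReflect G) (d * L + e * M) =
      ((-1 : ℂ) ^ (d + e)) * ((n + 1 - d : ℕ) : ℂ) * ((n' + 1 - e : ℕ) : ℂ) * (((∫ u : ℝ, ‖h u‖ ^ 2 : ℝ)) : ℂ) := by
  classical
  set N2 : ℂ := (((∫ u : ℝ, ‖h u‖ ^ 2 : ℝ)) : ℂ) with hN2
  set P : Finset (ℕ × ℕ) := Finset.range (n + 1) ×ˢ Finset.range (n' + 1) with hP
  set a : ℕ × ℕ → ℝ → ℂ := fun ij u ↦ ((-1 : ℂ) ^ (ij.1 + ij.2)) * h (u + (n * L + n' * M) / 2 - ij.1 * L - ij.2 * M) with ha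
  have hGa : ∀ u, G u = ∑ ij ∈ P, a ij u := fun u ↦ by rw [hG]
  have hblk : ∀ ij : ℕ × ℕ, IsWeilTest (a ij) := fun ij ↦ by
    have := (hh.weilTranslate (ij.1 * L + ij.2 * M - (n * L + n' * M) / 2)).const_mul ((-1 : ℂ) ^ (ij.1 + ij.2))
    convert this using 1; funext u; simp only [ha, weilTranslate]; ring_nf
  have hterm : ∀ ij kl : ℕ × ℕ, Integrable fun u : ℝ ↦ a ij u * conj (a kl (u - (d * L + e * M))) := fun ij kl ↦
    (hblk ij).integrable_mul (Complex.continuous_conj.comp ((hblk kl).1.continuous.comp (continuous_id.sub continuous_const)))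
  have hpair : ∀ ij kl : ℕ × ℕ, ij ∈ P → kl ∈ P → ∫ u : ℝ, a ij u * conj (a kl (u - (d * L + e * M))) =
      if ij = (kl.1 + d, kl.2 + e) then ((-1 : ℂ) ^ (d + e)) * N2 else 0 := by
    intro ij kl hij hkl
    rw [hP, Finset.mem_product, Finset.mem_range, Finset.mem_range] at hij hkl
    have hprod : ∀ u : ℝ, a ij u * conj (a kl (u - (d * L + e * M))) =
        ((-1 : ℂ) ^ (ij.1 + ij.2 + (kl.1 + kl.2))) * (h (u + (n * L + n' * M) / 2 - ij.1 * L - ij.2 * M) *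
          conj (h (u - (d * L + e * M) + (n * L + n' * M) / 2 - kl.1 * L - kl.2 * M))) := by
      intro u
      simp only [ha, map_mul, map_pow, map_neg, map_one]
      ring
    simp_rw [hprod]
    rw [integral_const_mul]
    split_ifs with hcase
    · subst hcase
      have hshift : ∀ u : ℝ, h (u + (n * L + n' * M) / 2 - ((kl.1 + d : ℕ) : ℝ) * L - ((kl.2 + e : ℕ) : ℝ) * M) *
          conj (h (u - (d * L + e * M) + (n * L + n' * M) / 2 - kl.1 * L - kl.2 * M)) =
          (fun v : ℝ ↦ ((‖h v‖ ^ 2 : ℝ) : ℂ)) (u + ((n * L + n' * M) / 2 - ((kl.1 + d : ℕ) : ℝ) * L - ((kl.2 + e : ℕ) : ℝ) * M)) := by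
        intro u
        have e1 : u - (d * L + e * M) + (n * L + n' * M) / 2 - kl.1 * L - kl.2 * M =
            u + ((n * L + n' * M) / 2 - ((kl.1 + d : ℕ) : ℝ) * L - ((kl.2 + e : ℕ) : ℝ) * M) := by push_cast; ring
        rw [e1, show u + (n * L + n' * M) / 2 - ((kl.1 + d : ℕ) : ℝ) * L - ((kl.2 + e : ℕ) : ℝ) * M =
          u + ((n * L + n' * M) / 2 - ((kl.1 + d : ℕ) : ℝ) * L - ((kl.2 + e : ℕ) : ℝ) * M) by ring, Complex.mul_conj, Complex.normSq_eq_norm_sq]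
      simp_rw [hshift]
      rw [integral_add_right_eq_self (fun v : ℝ ↦ ((‖h v‖ ^ 2 : ℝ) : ℂ)), integral_complex_ofReal, ← hN2]
      have : ((-1 : ℂ) ^ (kl.1 + d + (kl.2 + e) + (kl.1 + kl.2))) = (-1) ^ (d + e) := by
        rw [show kl.1 + d + (kl.2 + e) + (kl.1 + kl.2) = 2 * (kl.1 + kl.2) + (d + e) by ring, pow_add, pow_mul]; norm_num
      rw [this]
    · have hz : ∀ u : ℝ, h (u + (n * L + n' * M) / 2 - ij.1 * L - ij.2 * M) *
          conj (h (u - (d * L + e * M) + (n * L + n' * M) / 2 - kl.1 * L - kl.2 * M)) = 0 := fun u ↦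
        block2_mul_conj_eq_zero (n := n) (n' := n') hsep hsupp (i := ij.1) (j := ij.2) (i' := kl.1) (j' := kl.2)
          (d := (d : ℤ)) (e := (e : ℤ)) (by rw [abs_le]; constructor <;> omega)
          (by rw [abs_le]; constructor <;> omega)
          (fun hc ↦ hcase (Prod.ext (by exact_mod_cast hc.1) (by exact_mod_cast hc.2))) u
      simp_rw [hz]
      simp
  have hint : ∀ u : ℝ, G u * conj (G (u - (d * L + e * M))) = ∑ ij ∈ P, ∑ kl ∈ P, a ij u * conj (a kl (u - (d * L + e * M))) := by
    intro u
    rw [hGa, hGa, map_sum, Finset.sum_mul_sum]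
  rw [weilConv_weilReflect_apply']
  simp_rw [hint]
  rw [integral_finsetSum _ fun ij _ ↦ integrable_finsetSum _ fun kl _ ↦ hterm ij kl]
  simp_rw [integral_finsetSum _ fun kl _ ↦ hterm _ kl]
  rw [Finset.sum_congr rfl fun ij hij ↦ Finset.sum_congr rfl fun kl hkl ↦ hpair ij kl hij hkl, Finset.sum_comm]
  simp_rw [Finset.sum_ite_eq' P]
  rw [Finset.sum_ite, Finset.sum_const_zero, add_zero, Finset.sum_const]
  have hcard : (P.filter fun kl ↦ (kl.1 + d, kl.2 + e) ∈ P) = Finset.range (n + 1 - d) ×ˢ Finset.range (n' + 1 - e) := by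
    ext kl
    simp only [hP, Finset.mem_filter, Finset.mem_product, Finset.mem_range]
    omega
  rw [hcard, Finset.card_product, Finset.card_range, Finset.card_range, nsmul_eq_mul]
  push_cast
  ring

include hG hsep in
/-- `‖G‖₂² = (n+1)(n'+1)‖h‖₂²` (the zero lag; needs the separation box `n ≤ A`, `n' ≤ B`). -/
theorem integral_norm_sq_comb2 (hh : IsWeilTest h) (hsupp : tsupport h ⊆ Icc (-δ) δ) (hA : n ≤ A) (hB : n' ≤ B) :
    ∫ u : ℝ, ‖G u‖ ^ 2 = ((n : ℝ) + 1) * ((n' : ℝ) + 1) * ∫ u : ℝ, ‖h u‖ ^ 2 := by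
  have h0 := weilConv_weilReflect_comb2_lag hG hsep hh hsupp (d := 0) (e := 0) (by simpa using hA) (by simpa using hB)
  rw [Nat.cast_zero, zero_mul, zero_mul, add_zero, weilConv_weilReflect_apply_zero, add_zero, pow_zero, one_mul, Nat.sub_zero,
    Nat.sub_zero] at h0
  exact_mod_cast h0

end Comb

/-! ## §2  The all-powers deletion identity at a general lag variable `L = log p` (cf. `SemilocalDeletionAllPowers` §1) -/

/-- At `p^d`, `d ≠ 0`, `p ∈ S`: the deleted weight is `log p/(√p)^d`. -/
theorem coeff_erase_sub_prime_pow {S : Finset ℕ} {p : ℕ} (hp : p.Prime) (hpS : p ∈ S) {d : ℕ} (hd : d ≠ 0) :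
    weilSemilocalCoeff (S.erase p) (p ^ d) = weilSemilocalCoeff S (p ^ d) - Real.log p / Real.sqrt p ^ d := by
  rw [eq_sub_iff_add_eq, ← eq_sub_iff_add_eq']
  symm
  have hsq : ∀ n : ℕ, Real.sqrt ((p : ℝ) ^ n) = Real.sqrt p ^ n := fun n ↦ by
    induction n with
    | zero => simp
    | succ n ih => rw [pow_succ, Real.sqrt_mul (by positivity), ih, pow_succ]
  unfold weilSemilocalCoeff
  have h1 : (p ^ d).primeFactors ⊆ S := by
    rw [Nat.primeFactors_prime_pow hd hp, Finset.singleton_subset_iff]; exact hpS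
  have h2 : ¬ (p ^ d).primeFactors ⊆ S.erase p := by
    rw [Nat.primeFactors_prime_pow hd hp, Finset.singleton_subset_iff]; exact Finset.notMem_erase p S
  rw [if_pos h1, if_neg h2, ArithmeticFunction.vonMangoldt_apply_pow hd, ArithmeticFunction.vonMangoldt_apply_prime hp,
    sub_zero]
  push_cast
  rw [hsq]

/-- **All-powers deletion identity at a lag variable.** For `p ∈ S` prime, `L = log p`, `tsupport g ⊆ [−c, c]` and `2c < (m+1)L`:
`Re Q_{S∖p}(g) − Re Q_S(g) = Σ_{d<m} (L/(√p)^{d+1})·Re(k((d+1)L) + k(−(d+1)L))` (the form of `SemilocalDeletionAllPowers` §1 with the lag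
as a variable, as the comb lemmas are stated). -/
theorem re_erase_sub_eq_sum_lag {g : ℝ → ℂ} {S : Finset ℕ} {p : ℕ} {L c : ℝ} {m : ℕ} (hg : IsWeilTest g) (hp : p.Prime) (hpS : p ∈ S)
    (hLp : L = Real.log p) (hsupp : tsupport g ⊆ Icc (-c) c) (hm : 2 * c < (m + 1) * L) :
    (weilSemilocalQuadratic (S.erase p) g).re - (weilSemilocalQuadratic S g).re =
      ∑ d ∈ Finset.range m, L / Real.sqrt p ^ (d + 1) *
        (weilConv g (weilReflect g) ((d + 1) * L) + weilConv g (weilReflect g) (-((d + 1) * L))).re := by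
  subst hLp
  classical
  set k := weilConv g (weilReflect g) with hkdef
  have hlp : 0 < Real.log p := Real.log_pos (by exact_mod_cast hp.one_lt)
  set N : ℕ := max ⌊Real.exp (2 * c)⌋₊ (p ^ m) with hNdef
  have hN : 2 * c < Real.log ((N : ℝ) + 1) := by
    rw [Real.lt_log_iff_exp_lt (by positivity)]
    have h1 : Real.exp (2 * c) < (⌊Real.exp (2 * c)⌋₊ : ℝ) + 1 := Nat.lt_floor_add_one _
    have h2 : ((⌊Real.exp (2 * c)⌋₊ : ℕ) : ℝ) ≤ N := by exact_mod_cast le_max_left _ _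
    linarith
  have hks : tsupport k ⊆ Icc (-Real.log ((N : ℝ) + 1)) (Real.log ((N : ℝ) + 1)) :=
    (tsupport_weilConv_weilReflect_subset (a := c) hg.2 hsupp).trans (Icc_subset_Icc (by linarith) (by linarith))
  have hk : IsWeilTest k := hg.weilConv hg.weilReflect
  set w : ℕ → ℝ := fun n ↦ weilSemilocalCoeff S n - weilSemilocalCoeff (S.erase p) n with hw
  set f : ℕ → ℂ := fun n ↦ ((w n : ℝ) : ℂ) * (k (Real.log n) + k (-Real.log n)) with hf
  -- the difference of the two forms is the finite atom sum over `n ≤ N`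
  have hdiff : weilSemilocalQuadratic (S.erase p) g - weilSemilocalQuadratic S g = ∑ n ∈ Finset.range (N + 1), f n := by
    have hS := weilSemilocalPrimeTerm_eq_sum_of_tsupport_subset S hk.1.continuous N hks
    have hS' := weilSemilocalPrimeTerm_eq_sum_of_tsupport_subset (S.erase p) hk.1.continuous N hks
    have hpt : weilSemilocalPrimeTerm S k - weilSemilocalPrimeTerm (S.erase p) k = ∑ n ∈ Finset.range (N + 1), f n := by
      rw [hS, hS', ← Finset.sum_sub_distrib]
      refine Finset.sum_congr rfl fun n _ ↦ ?_
      rw [hf, hw]; push_cast; ring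
    unfold weilSemilocalQuadratic weilSemilocalFunctional
    rw [← hkdef]
    linear_combination hpt
  -- only the atoms `n = p^{d+1}`, `d < m`, survive
  set e : ℕ → ℕ := fun d ↦ p ^ (d + 1) with he
  have heinj : Set.InjOn e (Finset.range m) := fun a _ b _ h ↦ by
    have := Nat.pow_right_injective hp.two_le h
    simpa using this
  have hsub : (Finset.range m).image e ⊆ Finset.range (N + 1) := by
    intro n hn
    obtain ⟨d, hd, rfl⟩ := Finset.mem_image.1 hn
    rw [Finset.mem_range] at hd ⊢
    have h3 : e d ≤ p ^ m := Nat.pow_le_pow_right hp.pos hd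
    have h4 : p ^ m ≤ N := le_max_right _ _
    omega
  have hvan : ∀ n ∈ Finset.range (N + 1), n ∉ (Finset.range m).image e → f n = 0 := by
    intro n _ hn
    rw [hf]; dsimp only
    by_cases hpow : ∃ d : ℕ, d ≠ 0 ∧ n = p ^ d
    · obtain ⟨d, hd, rfl⟩ := hpow
      -- then `d ≥ m + 1`, so `log n ≥ (m+1) log p > 2c` and both `k`-values vanish
      have hdm : m + 1 ≤ d := by
        by_contra hlt
        push Not at hlt
        refine hn (Finset.mem_image.2 ⟨d - 1, Finset.mem_range.2 (by omega), ?_⟩)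
        rw [he]; dsimp only; rw [Nat.sub_add_cancel (Nat.one_le_iff_ne_zero.2 hd)]
      have hlog : 2 * c < |Real.log ((p ^ d : ℕ) : ℝ)| := by
        push_cast
        rw [Real.log_pow, abs_of_nonneg (by positivity)]
        have : ((m : ℝ) + 1) * Real.log p ≤ d * Real.log p :=
          mul_le_mul_of_nonneg_right (by exact_mod_cast hdm) hlp.le
        linarith
      rw [hkdef, weilConv_weilReflect_eq_zero_of_lt hg hsupp hlog,
        weilConv_weilReflect_eq_zero_of_lt hg hsupp (by rwa [abs_neg]), add_zero, mul_zero]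
    · push Not at hpow
      -- deleting `p` does not change the coefficient at `n` unless `n` is a positive power of `p`
      have hw0 : w n = 0 := by
        rw [hw]; dsimp only
        by_cases hpp : IsPrimePow n
        · obtain ⟨q, e, hq, he, rfl⟩ := (isPrimePow_nat_iff _).1 hpp
          have hqp : q ≠ p := fun h ↦ hpow e he.ne' (by rw [h])
          rw [weilSemilocalCoeff_erase_prime_pow_of_ne S hq he.ne' hqp, sub_self]
        · rw [weilSemilocalCoeff_of_not_isPrimePow S hpp, weilSemilocalCoeff_of_not_isPrimePow (S.erase p) hpp, sub_self]
      rw [hw0]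
      simp
  have hre : (weilSemilocalQuadratic (S.erase p) g).re - (weilSemilocalQuadratic S g).re =
      (∑ d ∈ Finset.range m, f (e d)).re := by
    rw [← Complex.sub_re, hdiff, ← Finset.sum_subset hsub hvan, Finset.sum_image heinj]
  rw [hre, Complex.re_sum]
  refine Finset.sum_congr rfl fun d _ ↦ ?_
  rw [hf, hw, he]; dsimp only
  rw [show weilSemilocalCoeff S (p ^ (d+1)) - weilSemilocalCoeff (S.erase p) (p ^ (d+1)) = Real.log p / Real.sqrt p ^ (d + 1) by
        rw [coeff_erase_sub_prime_pow hp hpS (Nat.add_one_ne_zero d)]; ring, Complex.re_ofReal_mul]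
  push_cast
  rw [Real.log_pow]
  push_cast
  ring_nf

/-! ## §3  Deleting TWO primes under the 2D comb: exact value and the ADDITIVE all-window bound -/

section Pair

variable {h : ℝ → ℂ} {δ L M : ℝ} {n n' : ℕ} {A B : ℕ} {G : ℝ → ℂ} {S : Finset ℕ} {p q : ℕ} {mp mq : ℕ}
  (hG : ∀ t : ℝ, G t = ∑ ij ∈ Finset.range (n + 1) ×ˢ Finset.range (n' + 1),
    ((-1 : ℂ) ^ (ij.1 + ij.2)) * h (t + (n * L + n' * M) / 2 - ij.1 * L - ij.2 * M))
  (hsep : ∀ a b : ℤ, |a| ≤ A → |b| ≤ B → (a ≠ 0 ∨ b ≠ 0) → 2 * δ < |(a : ℝ) * L + b * M|)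
include hG hsep

/-- **Deleting `p` under the 2D comb (exact).** With `L = log p`, `mp` visible powers of `p` on the comb's window (`n ≤ mp`,
`2((nL + n'M)/2 + δ) < (mp + 1)L`, separation box `n + mp ≤ A`, `n' ≤ B`): `Re Q_{S∖p}(G) − Re Q_S(G) = 2L(n'+1)‖h‖₂²·Σ_{d<n}(n−d)(−1/√p)^{d+1}` —
the second prime's blocks only multiply the one-prime comb value by `n' + 1` (no cross term: lags `dL` are never lags `eM`). -/
theorem re_erase_comb2 (hh : IsWeilTest h) (hsupp : tsupport h ⊆ Icc (-δ) δ) (hp : p.Prime) (hpS : p ∈ S) (hLp : L = Real.log p)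
    (hM : 0 ≤ M) (hn : n ≤ mp) (hwin : 2 * ((n * L + n' * M) / 2 + δ) < (mp + 1) * L) (hA : n + mp ≤ A) (hB : n' ≤ B) :
    (weilSemilocalQuadratic (S.erase p) G).re - (weilSemilocalQuadratic S G).re =
      2 * L * ((n' : ℝ) + 1) * (∫ u : ℝ, ‖h u‖ ^ 2) * ∑ d ∈ Finset.range n, ((n : ℝ) - d) * (-(Real.sqrt p)⁻¹) ^ (d + 1) := by
  have hL0 : 0 < L := by rw [hLp]; exact Real.log_pos (by exact_mod_cast hp.one_lt)
  obtain ⟨hGt, hGs⟩ := comb2_isWeilTest_tsupport hG hh hsupp hL0.le hM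
  rw [re_erase_sub_eq_sum_lag hGt hp hpS hLp hGs hwin]
  -- split the lag sum at `n`: the comb has no autocorrelation at lags `dL`, `d > n`
  rw [← Finset.sum_range_add_sum_Ico _ hn]
  set k := weilConv G (weilReflect G) with hk
  have hre : ∀ x : ℝ, (k x + k (-x)).re = 2 * (k x).re := by
    intro x
    have h1 : k (-x) = conj (k x) := by
      have := conj_weilConv_weilReflect_neg G x
      rw [← hk] at this
      rw [← this, Complex.conj_conj]
    rw [Complex.add_re, h1, Complex.conj_re]; ring
  have hlag : ∀ d : ℕ, n + (d + 1) ≤ A → k ((d + 1 : ℕ) * L) =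
      ((-1 : ℂ) ^ (d + 1)) * ((n + 1 - (d + 1) : ℕ) : ℂ) * ((n' + 1 : ℕ) : ℂ) * (((∫ u : ℝ, ‖h u‖ ^ 2 : ℝ)) : ℂ) := by
    intro d hd
    have := weilConv_weilReflect_comb2_lag hG hsep hh hsupp (d := d + 1) (e := 0) hd (by simpa using hB)
    simpa using this
  have hval : ∀ d : ℕ, n + (d + 1) ≤ A → (k ((d + 1 : ℕ) * L)).re = (-1) ^ (d + 1) * ((n + 1 - (d + 1) : ℕ) : ℝ) * ((n' : ℝ) + 1) * ∫ u : ℝ, ‖h u‖ ^ 2 := by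
    intro d hd
    rw [hlag d hd]
    have : ((-1 : ℂ) ^ (d + 1)) * ((n + 1 - (d + 1) : ℕ) : ℂ) * ((n' + 1 : ℕ) : ℂ) * (((∫ u : ℝ, ‖h u‖ ^ 2 : ℝ)) : ℂ) =
        ((((-1 : ℝ) ^ (d + 1)) * ((n + 1 - (d + 1) : ℕ) : ℝ) * ((n' : ℝ) + 1) * ∫ u : ℝ, ‖h u‖ ^ 2 : ℝ) : ℂ) := by push_cast; ring
    rw [this, Complex.ofReal_re]
  have htail : ∑ d ∈ Finset.Ico n mp, L / Real.sqrt p ^ (d + 1) * (k ((d + 1) * L) + k (-((d + 1) * L))).re = 0 := by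
    refine Finset.sum_eq_zero fun d hd ↦ ?_
    rw [Finset.mem_Ico] at hd
    rw [hre, show ((d : ℝ) + 1) * L = ((d + 1 : ℕ) : ℝ) * L by push_cast; ring, hval d (by omega),
      show (n + 1 - (d + 1) : ℕ) = 0 by omega]
    simp
  rw [htail, add_zero, Finset.mul_sum]
  refine Finset.sum_congr rfl fun d hd ↦ ?_
  rw [Finset.mem_range] at hd
  rw [hre, show ((d : ℝ) + 1) * L = ((d + 1 : ℕ) : ℝ) * L by push_cast; ring, hval d (by omega),
    Nat.cast_sub (by omega : d + 1 ≤ n + 1)]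
  have hsq : Real.sqrt p ^ (d + 1) ≠ 0 := pow_ne_zero _ (Real.sqrt_ne_zero'.2 (by exact_mod_cast hp.pos))
  have hρ : (-(Real.sqrt p)⁻¹) ^ (d + 1) = (-1) ^ (d + 1) / Real.sqrt p ^ (d + 1) := by
    rw [neg_eq_neg_one_mul, mul_pow, inv_pow]; ring
  rw [hρ]
  field_simp
  push_cast
  ring

omit hsep in
/-- The comb hypothesis with the roles of the two lags swapped (reindex `(i, j) ↦ (j, i)`). -/
theorem comb2_swap : ∀ t : ℝ, G t = ∑ ij ∈ Finset.range (n' + 1) ×ˢ Finset.range (n + 1),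
    ((-1 : ℂ) ^ (ij.1 + ij.2)) * h (t + (n' * M + n * L) / 2 - ij.1 * M - ij.2 * L) := by
  intro t
  rw [hG t, Finset.sum_product, Finset.sum_product, Finset.sum_comm]
  refine Finset.sum_congr rfl fun j _ ↦ Finset.sum_congr rfl fun i _ ↦ ?_
  rw [add_comm j i]
  ring_nf

/-- **TWO PRIMES under the 2D comb: the deletion costs ADD EXACTLY.** For distinct primes `p, q ∈ S`, `L = log p`, `M = log q`,
visible-power counts `mp ≥ n`, `mq ≥ n'` on the comb window `c = (nL + n'M)/2 + δ` (`2c < (mp+1)L`, `2c < (mq+1)M`) and the separation box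
`n + mp ≤ A`, `n' + mq ≤ B`:
`Re Q_{S∖{p,q}}(G) − Re Q_S(G) = 2‖h‖₂²·[(n'+1)·L·Σ_{d<n}(n−d)(−1/√p)^{d+1} + (n+1)·M·Σ_{e<n'}(n'−e)(−1/√q)^{e+1}]` — the sum of the
two one-prime comb values (`SemilocalDeletionAllPowers.re_weilSemilocalQuadratic_erase_comb`), with NO interaction term.  Dividing by
`‖G‖₂² = (n+1)(n'+1)‖h‖₂²` and letting `n, n' → ∞` the quotient tends to `−(2 log p/(√p+1) + 2 log q/(√q+1))`: the two-prime all-window floor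
is the SUM of the one-prime floors (the sequel file packages the `≤ −[F_p(n−1)/(n+1) + F_q(n'−1)/(n'+1)]‖G‖₂²` form and the existence of separated combs). -/
theorem re_erase_erase_comb2 (hh : IsWeilTest h) (hsupp : tsupport h ⊆ Icc (-δ) δ) (hp : p.Prime) (hq : q.Prime) (hpq : p ≠ q)
    (hpS : p ∈ S) (hqS : q ∈ S) (hLp : L = Real.log p) (hMq : M = Real.log q) (hn : n ≤ mp) (hn' : n' ≤ mq)
    (hwp : 2 * ((n * L + n' * M) / 2 + δ) < (mp + 1) * L) (hwq : 2 * ((n * L + n' * M) / 2 + δ) < (mq + 1) * M)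
    (hA : n + mp ≤ A) (hB : n' + mq ≤ B) :
    (weilSemilocalQuadratic ((S.erase p).erase q) G).re - (weilSemilocalQuadratic S G).re =
      2 * (∫ u : ℝ, ‖h u‖ ^ 2) * (((n' : ℝ) + 1) * L * ∑ d ∈ Finset.range n, ((n : ℝ) - d) * (-(Real.sqrt p)⁻¹) ^ (d + 1) +
        ((n : ℝ) + 1) * M * ∑ e ∈ Finset.range n', ((n' : ℝ) - e) * (-(Real.sqrt q)⁻¹) ^ (e + 1)) := by
  have hL0 : 0 ≤ L := by rw [hLp]; exact (Real.log_pos (by exact_mod_cast hp.one_lt)).le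
  have hM0 : 0 ≤ M := by rw [hMq]; exact (Real.log_pos (by exact_mod_cast hq.one_lt)).le
  have h1 := re_erase_comb2 hG hsep hh hsupp hp hpS hLp hM0 hn hwp hA (le_trans (Nat.le_add_right n' mq) hB)
  -- the swapped comb deletes `q` from `S ∖ p`
  have hsep' : ∀ a b : ℤ, |a| ≤ B → |b| ≤ A → (a ≠ 0 ∨ b ≠ 0) → 2 * δ < |(a : ℝ) * M + b * L| := by
    intro a b ha hb hab
    have := hsep b a hb ha (hab.symm)
    rwa [add_comm] at this
  have hqS' : q ∈ S.erase p := Finset.mem_erase.2 ⟨hpq.symm, hqS⟩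
  have hwq' : 2 * ((n' * M + n * L) / 2 + δ) < (mq + 1) * M := by linarith
  have h2 := re_erase_comb2 (comb2_swap hG) hsep' hh hsupp hq hqS' hMq hL0 hn' hwq' hB (le_trans (Nat.le_add_right n mp) hA)
  linear_combination h1 + h2

end Pair

end Summit.RiemannHypothesis.RiemannHypothesis.Theorems.SemilocalDeletionPairCombs

end
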